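import Literature.Probability.RandomPlanarGeometry.ObservableClockPassage
import HarnessLib

/-!
# The clock form of the slit-crossing data: real Doob martingales at capacity stopping steps

Crux `Summit.CriticalPhenomena.CardyFormulaZ2.Theses.CardyUniqueLimit.CardyRigidity`
(stmt-CriticalPhenomena-0746), line `crossing_martingale`, stub `stub_slitCrossingData` (the
discrete crossing-martingale data of the bond-`ℤ²` exploration).  The registered stub asks, at
every scale `k`, for a discrete filtration, a REAL martingale `F`, stopping times `σ ≤ τ ≤ M_k`
with the (sign-reversed) discrete driving values up to time `s` measurable for `𝒢_σ`, stopped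
values bounded by `1`, and off a small event the stopped values within `ε_k` of a target process
`N^k_u` at some `u ∈ [s, s + Δ_k]`, resp. `[t, t + Δ_k]`.  Exactly as for the FK-Ising template
(`Loewner.exists_discreteMartingaleData_of_clock_of_bound`, `ObservableClockPassage.lean`, which
is complex-valued), such data are PACKAGED from the natural lattice objects — an adapted capacity
clock `θ_n` of the exploration prefix with small start and increments reaching `t`, a bounded real
variable `X` (the indicator of the fixed crossing event), its Doob martingale `E[X | 𝒢_n]`
(conditional crossing probability given the prefix; a slit-domain crossing probability by the
domain Markov property), locality of the driving process, and the approximation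
`|E[X | 𝒢_n] - N_{θ_n}| ≤ ε` for `θ_n ≤ t + Δ` — by stopping at the hitting steps of the levels
`s` and `t` (Duminil-Copin–Smirnov 2012, proof of Prop. 6.7; CDHKS 2014, §3; here for
Camia–Newman's crossing martingales, PTRF 139 (2007), §5).

* `Clock.exists_realMartingaleData_of_clock` — one scale, real-valued `X` with `|X| ≤ 1` a.e.;
* `slitCrossing_data_of_clockForm` — all scales: the clock form EVENTUALLY in `k` (early scales
  are served by trivial data) gives the per-scale data of the stub, for an arbitrary family of
  measurable continuous-path processes `V^k` and targets `N^k` on a probability space; the stub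
  is the case `V^k_u = -drivingFunction φ_k (bondInterfaceIn D (E δ_k) ·) u`,
  `N^k_u = crossingObs f eval x m M d u (V^k)`.
-/

noncomputable section

open MeasureTheory Filter Set Topology
open scoped NNReal ENNReal

namespace Summit.CriticalPhenomena.CardyFormulaZ2.Cruxes.CardyRigidity.CrossingMartingale

namespace Clock

open Literature.Probability.RandomPlanarGeometry.Loewner

variable {Ω : Type*} {m : MeasurableSpace Ω} {P : Measure Ω} [IsProbabilityMeasure P]

/-- **One scale, real form.**  From an adapted clock `θ` with step bound `M`, a driving process
`V` that is `𝒢_M`-measurable and local for the clock, a real variable `X` with `|X| ≤ 1` a.e.,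
and a real target `N_u`: if off `bad` the clock starts below `Δ`, reaches `t` by step `M` with
increments `≤ Δ`, and `|E[X | 𝒢_n] - N_{θ_n}| ≤ ε` a.e. off `bad` whenever `θ_n ≤ t + Δ`, then
the Doob martingale `F_n = E[X | 𝒢_n]` stopped at the hitting steps `σ ≤ τ ≤ M` of the levels
`s < t` has `|F_σ|, |F_τ| ≤ 1` a.e., `V_u` is `𝒢_σ`-measurable for `u ≤ s`, and off `bad` the
stopped values are within `ε` of `N_u` at some `u ∈ [s, s + Δ]`, resp. `[t, t + Δ]`.
[cite: DuminilCopinSmirnov2012Clay, Prop. 6.7 (proof, p. 29)] [cite: CamiaNewman2007, §5] -/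
theorem exists_realMartingaleData_of_clock (𝒢 : Filtration ℕ m) {θ : ℕ → Ω → ℝ≥0}
    (hθ : Adapted 𝒢 θ) {V : ℝ≥0 → Ω → ℝ} {M : ℕ} (hVM : ∀ u, Measurable[𝒢 M] (V u))
    (hVloc : ∀ n u, Measurable[𝒢 n] ({ω | u ≤ θ n ω}.indicator (V u)))
    (X : Ω → ℝ) (hX1 : ∀ᵐ ω ∂P, |X ω| ≤ 1)
    (N : ℝ≥0 → Ω → ℝ) {s t : ℝ≥0} (hst : s < t) {ε Δ : ℝ≥0} {bad : Set Ω}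
    (hθ0 : ∀ ω, ω ∉ bad → θ 0 ω ≤ Δ)
    (hreach : ∀ ω, ω ∉ bad → ∃ n ≤ M, t ≤ θ n ω)
    (hincr : ∀ ω, ω ∉ bad → ∀ n, n < M → θ (n + 1) ω ≤ θ n ω + Δ)
    (happrox : ∀ᵐ ω ∂P, ω ∉ bad → ∀ n, n ≤ M → θ n ω ≤ t + Δ →
      |(P[X|𝒢 n]) ω - N (θ n ω) ω| ≤ ε) :
    ∃ (F : ℕ → Ω → ℝ) (σ τ : Ω → WithTop ℕ) (hσ : IsStoppingTime 𝒢 σ),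
      IsStoppingTime 𝒢 τ ∧ Martingale F 𝒢 P ∧ σ ≤ τ ∧ (∀ ω, τ ω ≤ M) ∧
      (∀ u, u ≤ s → Measurable[hσ.measurableSpace] (V u)) ∧
      (∀ᵐ ω ∂P, ‖stoppedValue F σ ω‖ ≤ 1) ∧ (∀ᵐ ω ∂P, ‖stoppedValue F τ ω‖ ≤ 1) ∧
      ∀ᵐ ω ∂P, ω ∉ bad →
        (∃ u ∈ Icc s (s + Δ), ‖stoppedValue F σ ω - N u ω‖ ≤ ε) ∧
        (∃ u ∈ Icc t (t + Δ), ‖stoppedValue F τ ω - N u ω‖ ≤ ε) := by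
  -- the Doob martingale
  set F : ℕ → Ω → ℝ := fun n ↦ P[X|𝒢 n] with hF
  have hmart : Martingale F 𝒢 P := martingale_condExp X 𝒢 P
  have hFb : ∀ᵐ ω ∂P, ∀ n, ‖F n ω‖ ≤ 1 := by
    have hX1' : ∀ᵐ ω ∂P, ‖X ω‖ ≤ ((1 : ℝ≥0) : ℝ) := by
      filter_upwards [hX1] with ω hω
      simpa [Real.norm_eq_abs] using hω
    refine ae_all_iff.2 fun n ↦ ?_
    filter_upwards [ae_bdd_norm_condExp_of_ae_bdd_norm (m := 𝒢 n) hX1'] with ω hω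
    simpa using hω
  -- the hitting steps
  set νs : Ω → ℕ := fun ω ↦ hittingBtwn θ (Ici s) 0 M ω with hνs
  set νt : Ω → ℕ := fun ω ↦ hittingBtwn θ (Ici t) 0 M ω with hνt
  have hσ : IsStoppingTime 𝒢 (fun ω ↦ ((νs ω : ℕ) : WithTop ℕ)) :=
    isStoppingTime_clock_hittingBtwn hθ
  have hτ : IsStoppingTime 𝒢 (fun ω ↦ ((νt ω : ℕ) : WithTop ℕ)) :=
    isStoppingTime_clock_hittingBtwn hθ
  have hle : ∀ ω, νs ω ≤ νt ω := fun ω ↦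
    hittingBtwn_anti θ 0 M (Ici_subset_Ici.2 hst.le) ω
  have hνtM : ∀ ω, νt ω ≤ M := fun ω ↦ hittingBtwn_le (u := θ) ω
  have hνsM : ∀ ω, νs ω ≤ M := fun ω ↦ (hle ω).trans (hνtM ω)
  refine ⟨F, fun ω ↦ ((νs ω : ℕ) : WithTop ℕ), fun ω ↦ ((νt ω : ℕ) : WithTop ℕ), hσ, hτ, hmart,
    fun ω ↦ by simp only; exact_mod_cast hle ω, fun ω ↦ by simp only; exact_mod_cast hνtM ω,
    fun u hu ↦ measurable_hittingBtwn_of_local hθ hu (hVM u) (fun n ↦ hVloc n u), ?_, ?_, ?_⟩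
  · filter_upwards [hFb] with ω hω
    exact hω (νs ω)
  · filter_upwards [hFb] with ω hω
    exact hω (νt ω)
  · filter_upwards [happrox] with ω hωapp hωbad
    have hreach_t : ∃ n ≤ M, t ≤ θ n ω := hreach ω hωbad
    have hreach_s : ∃ n ≤ M, s ≤ θ n ω := by
      obtain ⟨n, hn, hnt⟩ := hreach_t
      exact ⟨n, hn, hst.le.trans hnt⟩
    have hincr' := hincr ω hωbad
    have hs1 : s ≤ θ (νs ω) ω := le_clock_hittingBtwn hreach_s
    have hs2 : θ (νs ω) ω ≤ s + Δ := clock_hittingBtwn_le_add (hθ0 ω hωbad) hincr'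
    have ht1 : t ≤ θ (νt ω) ω := le_clock_hittingBtwn hreach_t
    have ht2 : θ (νt ω) ω ≤ t + Δ := clock_hittingBtwn_le_add (hθ0 ω hωbad) hincr'
    refine ⟨⟨θ (νs ω) ω, ⟨hs1, hs2⟩, ?_⟩, ⟨θ (νt ω) ω, ⟨ht1, ht2⟩, ?_⟩⟩
    · have h := hωapp hωbad (νs ω) (hνsM ω) (hs2.trans (add_le_add hst.le le_rfl))
      have hsv : stoppedValue F (fun ω ↦ ((νs ω : ℕ) : WithTop ℕ)) ω = F (νs ω) ω := rfl
      rw [hsv, Real.norm_eq_abs]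
      exact h
    · have h := hωapp hωbad (νt ω) (hνtM ω) ht2
      have hsv : stoppedValue F (fun ω ↦ ((νt ω : ℕ) : WithTop ℕ)) ω = F (νt ω) ω := rfl
      rw [hsv, Real.norm_eq_abs]
      exact h

omit [IsProbabilityMeasure P] in
/-- **Trivial data at a scale** (used for the finitely many early scales): the constant
filtration `m`, the zero martingale, `σ = τ = 0`, `bad = univ`.  Only the measurability of the
driving values is needed. [folklore] -/
theorem exists_trivialData [IsFiniteMeasure P] {V : ℝ≥0 → Ω → ℝ} (hVm : ∀ u, Measurable (V u))
    (N : ℝ≥0 → Ω → ℝ) (s t : ℝ≥0) (ε Δ : ℝ≥0) :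
    ∃ (𝒢 : Filtration ℕ m) (F : ℕ → Ω → ℝ) (σ τ : Ω → WithTop ℕ)
      (hσ : IsStoppingTime 𝒢 σ) (Mk : ℕ) (bad : Set Ω),
      IsStoppingTime 𝒢 τ ∧ Martingale F 𝒢 P ∧ σ ≤ τ ∧ (∀ ω, τ ω ≤ Mk) ∧
      (∀ u, u ≤ s → Measurable[hσ.measurableSpace] (V u)) ∧
      (∀ᵐ ω ∂P, ‖stoppedValue F σ ω‖ ≤ 1) ∧ (∀ᵐ ω ∂P, ‖stoppedValue F τ ω‖ ≤ 1) ∧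
      MeasurableSet bad ∧ P bad ≤ P univ ∧
      ∀ᵐ ω ∂P, ω ∉ bad →
        (∃ u ∈ Icc s (s + Δ), ‖stoppedValue F σ ω - N u ω‖ ≤ ε) ∧
        (∃ u ∈ Icc t (t + Δ), ‖stoppedValue F τ ω - N u ω‖ ≤ ε) := by
  set 𝒢 : Filtration ℕ m := Filtration.const ℕ m le_rfl with h𝒢
  have hσ : IsStoppingTime 𝒢 (fun _ : Ω ↦ ((0 : ℕ) : WithTop ℕ)) := isStoppingTime_const 𝒢 _
  refine ⟨𝒢, 0, fun _ ↦ ((0 : ℕ) : WithTop ℕ), fun _ ↦ ((0 : ℕ) : WithTop ℕ), hσ, 0, univ, hσ,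
    martingale_zero _ _ _ , le_rfl, fun _ ↦ le_rfl, fun u _ ↦ ?_, ?_, ?_,
    MeasurableSet.univ, le_rfl, Eventually.of_forall fun ω hω ↦ (hω (mem_univ ω)).elim⟩
  · -- `𝒢_σ = m` for the constant time `0` of the constant filtration
    intro B hB
    refine (hσ.measurableSet _).2 ⟨hVm u hB, fun i ↦ ?_⟩
    exact (hVm u hB).inter (MeasurableSet.const _)
  · exact Eventually.of_forall fun ω ↦ by simp [stoppedValue]
  · exact Eventually.of_forall fun ω ↦ by simp [stoppedValue]

end Clock

/-- **The slit-crossing data from its clock form.**  Let `V^k_u` be measurable continuous-path(or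
not) real processes and `N^k_u` real targets on a probability space `(Ω', P)`, and `s < t`.  If
there are `ε_k, Δ_k, η_k → 0` such that for all large `k` there exist a discrete filtration `𝒢`,
an adapted clock `θ` with step bound `M_k`, a real variable `X` with `|X| ≤ 1` a.e. and a
measurable `bad` with `P(bad) ≤ η_k`, such that `V^k` is `𝒢_{M_k}`-measurable and local for
`θ`, and off `bad`: `θ_0 ≤ Δ_k`, the level `t` is reached by step `M_k` with increments `≤ Δ_k`,
and `|E[X | 𝒢_n] - N^k_{θ_n}| ≤ ε_k` a.e. for `n ≤ M_k` with `θ_n ≤ t + Δ_k` — then the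
per-scale data of `stub_slitCrossingData` exist at EVERY scale (trivial data at the early ones):
filtration, real martingale, stopping times `σ ≤ τ ≤ M_k`, `𝒢_σ`-measurability of `V^k_u`,
`u ≤ s`, stopped values bounded by `1`, and the two `ε_k`-approximations off `bad`.
[cite: CamiaNewman2007, §5] [cite: DuminilCopinSmirnov2012Clay, Prop. 6.7 (proof, p. 29)] -/
theorem slitCrossing_data_of_clockForm : ∀ {Ω' : Type} [MeasurableSpace Ω'] (P : MeasureTheory.Measure Ω') [MeasureTheory.IsProbabilityMeasure P] (V : ℕ → ℝ≥0 → Ω' → ℝ), (∀ k u, Measurable (V k u)) → ∀ (N : ℕ → ℝ≥0 → Ω' → ℝ) (s t : ℝ≥0), s < t → (∃ ε Δ η : ℕ → ℝ≥0, Filter.Tendsto ε Filter.atTop (nhds 0) ∧ Filter.Tendsto Δ Filter.atTop (nhds 0) ∧ Filter.Tendsto η Filter.atTop (nhds 0) ∧ ∀ᶠ k in Filter.atTop, ∃ (𝒢 : MeasureTheory.Filtration ℕ ‹MeasurableSpace Ω'›) (θ : ℕ → Ω' → ℝ≥0) (Mk : ℕ) (X : Ω' → ℝ) (bad : Set Ω'),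 MeasureTheory.Adapted 𝒢 θ ∧ (∀ ω, ω ∉ bad → θ 0 ω ≤ Δ k) ∧ (∀ u, Measurable[𝒢 Mk] (V k u)) ∧ (∀ n u, Measurable[𝒢 n] ({ω | u ≤ θ n ω}.indicator (V k u))) ∧ (∀ᵐ ω ∂P, |X ω| ≤ 1) ∧ MeasurableSet bad ∧ P bad ≤ η k ∧ (∀ ω, ω ∉ bad → ∃ n ≤ Mk, t ≤ θ n ω) ∧ (∀ ω, ω ∉ bad → ∀ n, n < Mk → θ (n + 1) ω ≤ θ n ω + Δ k) ∧ (∀ᵐ ω ∂P, ω ∉ bad → ∀ n, n ≤ Mk → θ n ω ≤ t + Δ k → |(P[X|𝒢 n]) ω - N k (θ n ω) ω| ≤ ε k)) → ∃ ε Δ η : ℕ → ℝ≥0, Filter.Tendsto ε Filter.atTop (nhds 0) ∧ Filter.Tendsto Δ Filter.atTop (nhds 0) ∧ Filter.Tendsto η Filter.atTop (nhds 0) ∧ ∀ k, ∃ (𝒢 : MeasureTheory.Filtration ℕ ‹MeasurableSpace Ω'›) (F : ℕ → Ω' → ℝ) (σ τ : Ω' → WithTop ℕ) (hσ : MeasureTheory.IsStoppingTime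 𝒢 σ) (Mk : ℕ) (bad : Set Ω'), MeasureTheory.IsStoppingTime 𝒢 τ ∧ MeasureTheory.Martingale F 𝒢 P ∧ σ ≤ τ ∧ (∀ ω, τ ω ≤ Mk) ∧ (∀ u, u ≤ s → Measurable[hσ.measurableSpace] fun ω ↦ V k u ω) ∧ (∀ᵐ ω ∂P, ‖MeasureTheory.stoppedValue F σ ω‖ ≤ 1) ∧ (∀ᵐ ω ∂P, ‖MeasureTheory.stoppedValue F τ ω‖ ≤ 1) ∧ MeasurableSet bad ∧ P bad ≤ η k ∧ ∀ᵐ ω ∂P, ω ∉ bad → (∃ u ∈ Set.Icc s (s + Δ k), ‖MeasureTheory.stoppedValue F σ ω - N k u ω‖ ≤ ε k) ∧ (∃ u ∈ Set.Icc t (t + Δ k), ‖MeasureTheory.stoppedValue F τ ω - N k u ω‖ ≤ ε k) := by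
  intro Ω' _ P _ V hVm N s t hst h
  obtain ⟨ε, Δ, η, hε, hΔ, hη, hev⟩ := h
  obtain ⟨K, hK⟩ := eventually_atTop.1 hev
  -- modify `η` at the early scales
  refine ⟨ε, Δ, fun k ↦ if k < K then 1 else η k, hε, hΔ, ?_, fun k ↦ ?_⟩
  · refine hη.congr' ?_
    filter_upwards [eventually_ge_atTop K] with k hk
    rw [if_neg (not_lt.2 hk)]
  · by_cases hk : k < K
    · -- early scale: trivial data
      obtain ⟨𝒢, F, σ, τ, hσ, Mk, bad, hτ, hmart, hστ, hτM, hVσ, hFσ, hFτ, hbad, hPbad, happ⟩ :=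
        Clock.exists_trivialData (P := P) (hVm k) (N k) s t (ε k) (Δ k)
      refine ⟨𝒢, F, σ, τ, hσ, Mk, bad, hτ, hmart, hστ, hτM, hVσ, hFσ, hFτ, hbad, ?_, happ⟩
      show P bad ≤ ((if k < K then (1 : ℝ≥0) else η k : ℝ≥0) : ℝ≥0∞)
      rw [if_pos hk, ENNReal.coe_one]
      exact prob_le_one
    · obtain ⟨𝒢, θ, Mk, X, bad, hθ, hθ0, hVM, hVloc, hX1, hbad, hPbad, hreach, hincr, happrox⟩ :=
        hK k (not_lt.1 hk)
      obtain ⟨F, σ, τ, hσ, hτ, hmart, hστ, hτM, hVσ, hFσ, hFτ, happ⟩ :=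
        Clock.exists_realMartingaleData_of_clock 𝒢 hθ hVM hVloc X hX1 (N k) hst hθ0 hreach
          hincr happrox
      refine ⟨𝒢, F, σ, τ, hσ, Mk, bad, hτ, hmart, hστ, hτM, hVσ, hFσ, hFτ, hbad, ?_, happ⟩
      show P bad ≤ ((if k < K then (1 : ℝ≥0) else η k : ℝ≥0) : ℝ≥0∞)
      rw [if_neg hk]
      exact hPbad

end Summit.CriticalPhenomena.CardyFormulaZ2.Cruxes.CardyRigidity.CrossingMartingale

end
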